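import Summits.QuantumFields.YangMills.Theorems.UnitScaleTiltProp7PinnedHodgeSplit
import Literature.MathematicalPhysics.QuantumFieldTheory.Balaban1983to89.T4Covariance
import HarnessLib

/-!
# Route `UnitScaleTilt`, crux K1 «MinimiserStabilityRegPr» (stmt-QuantumFields-19200), line «route-R» (S2, curved Hodge route) — THE φ-SIZE LETTER, file 1∕2:
# FLAT LATTICE POTENTIAL THEORY ON THE TORUS — the maximum principle by truncation, the pinned Dirichlet problem, and the TOTAL MASS of a function that is
# (sub-)harmonic off a homogeneous centre set: `|C|·Σ_x w(x) ≤ |T^{(j)}|·Σ_{c∈C} w(c)`, `|C|·Σ_x u(x)² ≤ |T^{(j)}|·Σ_{c∈C} u(c)²`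

Cell `ym3-torus`, D-0154 (3c) twin-width seat `ym-routeR-w1` (gen 0, session 2); `--supports stmt-QuantumFields-19200 --as helper`; THEOREMS ONLY (0 `def`, 0 `sorry`).
YM₃ on T³ is a ladder rung (R3), not the Clay problem; nothing here claims the stub, the crux, d = 4 or the mass gap.

WHY (numbers).  In the curved Hodge route of stub P (`Y = B + D_{U₀}φ`, ✓ p610574 `Prop7CovHodgeSplit.exists_covHodgeSplit`; constraint on the parts ✓ p611528
`Prop7CovHodgeConstraint.covConstraint_on_hodge_parts`) the ONE honest difference from the flat chain N1–N7 is the curvature commutator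
`‖(curl_{U₀} D_{U₀}φ)(p)‖ ≤ 2‖U₀(∂p) − 1‖·‖φ(x_p)‖` (✓ p601297 `Prop7CovariantCurlOfGrad.norm_curl_covD_le`): it sees the VALUE of the potential `φ`, and the naive bound
`Σ_x‖φ(x)‖² ≤ λ₁(Δ_{U₀})⁻¹·Σ‖D_{U₀}φ‖²` is volume-dependent (memo `N8-PACKAGE-MEMO-routeRw1g0.md` §3, 19200 evidence #51).  The PINNED potential is covariantly harmonic off the
set `C` of k-centres, so `‖φ‖` is SUB-MEAN-VALUE off `C` (Kato; file 2∕2 `Prop7PinnedHarmonicMass`); this file proves the real-variable fact that then bounds its mass by its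
centre values: a non-negative function, sub-mean-value off a centre set on which a group of lattice translations acts transitively, has
`|C|·Σ_x u(x)² ≤ |T^{(j)}|·Σ_{c∈C} u(c)²` — at the k-centres of the finest torus `|T|∕|C| = L^{dk}`, k-UNIFORM and VOLUME-FREE.

WHAT IS PROVED (sorry-free, no definition; `Site P j` the torus `T^{(j)}` with its translations `x + a`, `laplace 1` ∕ `grad 1` of `LatticeFieldCalculus`, `C : Finset (Site P j)` nonempty).
* §1 `laplace_one_apply`; `posPart_sub_sq_le` (truncation at `0` is monotone 1-Lipschitz); ★ `nonpos_of_laplace_nonpos_off` — MAXIMUM PRINCIPLE by truncation: `(Δv)(x) ≤ 0` off `C` and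
  `v ≤ 0` on `C` ⇒ `v ≤ 0` (the Dirichlet energy of `v⁺` is `≤ Σ_x v⁺Δv ≤ 0`, so `v⁺` is constant — `const_of_grad_eq_zero` — and vanishes on `C`); `le_of_laplace_nonpos_off_of_le_on`
  (comparison); `eq_of_harmonic_off` (uniqueness); ★ `exists_harmonic_ext` (the pinned Dirichlet problem is solvable: `h ↦ (h|_C, (Δh)|_{T∖C})` is an injective endomorphism of the
  finite-dimensional space of site functions, hence surjective).
* §2 `laplace_translate` (`Δ` commutes with translations); ★★ `card_mul_sum_eq_of_harmonic_off` — if every two points of `C` are exchanged by a `C`-preserving translation, every `h`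
  harmonic off `C` has `|C|·Σ_x h(x) = |T|·Σ_{c∈C} h(c)` (average `h` over the stabiliser of `C`: harmonic off `C`, constant on `C`, hence constant; read both sides off);
  ★★ `card_mul_sum_le_of_laplace_nonpos_off` (sub-mean-value ⇒ `≤`, by comparison with the harmonic extension); `laplace_sq_nonpos_of_subMean` (`u ≥ 0` with
  `2d·u(x) ≤ Σ_μ(u(x+e_μ) + u(x−e_μ))` ⇒ `(Δu²)(x) ≤ 0`, Cauchy–Schwarz); ★★ `card_mul_sum_sq_le_of_subMean_off` (`|C|·Σ_x u² ≤ |T|·Σ_C u²`).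

HONEST SCOPE.  Elementary lattice potential theory ([folklore]: discrete maximum principle; the harmonic measure of a homogeneous set is an equidistributed partition of unity);
no estimate of Bałaban's is asserted.

References: T. Bałaban, CMP 95 (1984) 17–40 [Balaban1984PropagatorsI] ((1.21) p.21: `Δ = ∂^*∂`, `⟨f, Δg⟩ = ⟨∂f, ∂g⟩`); CMP 102 (1985) 277–309 [Balaban1985Variational]
(Prop. 7 p.299, (141)–(143): the pinned representative).
-/

set_option autoImplicit false

noncomputable section

open scoped BigOperators

namespace Summit.QuantumFields.YangMills.Theorems.Prop7PinnedHarmonicMeasure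

open Literature.MathematicalPhysics.QuantumFieldTheory.Balaban1983to89
open Finset LatticeFieldCalculus
open B6Eq28LandauGaugeV1 (laplace_add laplace_smul laplace_sub laplace_zero)
open Summit.QuantumFields.YangMills.Theorems.Prop7PinnedHodgeSplit (sum_mul_laplace_eq_sum_grad_mul const_of_grad_eq_zero)

/-! ## §1 Flat lattice potential theory on `T^{(j)}`: maximum principle by truncation, the pinned Dirichlet problem -/

section Flat

variable {P : Params} {j : ℕ}

/-- `(Δw)(x) = Σ_μ (2w(x) − w(x+e_μ) − w(x−e_μ))` at lattice factor `1`. [cite: Balaban1984PropagatorsI, (1.21) p.21] -/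
theorem laplace_one_apply (w : SiteField P j ℝ) (x : Site P j) :
    laplace 1 w x = ∑ μ : Fin P.d, (2 * w x - w (x.shift μ) - w (x.unshift μ)) := by
  simp only [laplace, one_pow, one_smul]
  exact Finset.sum_congr rfl fun μ _ => by ring

/-- truncation at `0` is monotone and 1-Lipschitz: `(a⁺ − b⁺)² ≤ (a⁺ − b⁺)(a − b)`. [folklore] -/
theorem posPart_sub_sq_le (a b : ℝ) : (max a 0 - max b 0) ^ 2 ≤ (max a 0 - max b 0) * (a - b) := by
  rcases le_or_gt a 0 with ha | ha <;> rcases le_or_gt b 0 with hb | hb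
  · rw [max_eq_right ha, max_eq_right hb]; simp
  · rw [max_eq_right ha, max_eq_left hb.le]; nlinarith
  · rw [max_eq_left ha.le, max_eq_right hb]; nlinarith
  · rw [max_eq_left ha.le, max_eq_left hb.le]; nlinarith

/-- ★ **MAXIMUM PRINCIPLE BY TRUNCATION**: a function that is sub-mean-value off `C` (`(Δv)(x) ≤ 0` for `x ∉ C`) and `≤ 0` on the nonempty set `C` is `≤ 0` everywhere —
`Σ_x v⁺(x)(Δv)(x) ≤ 0` termwise, `= Σ_b (∂v⁺)(∂v) ≥ Σ_b (∂v⁺)²`, so `∂v⁺ = 0`, `v⁺` is constant, and it vanishes on `C`. [folklore] -/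
theorem nonpos_of_laplace_nonpos_off (C : Finset (Site P j)) (hC : C.Nonempty) (v : SiteField P j ℝ)
    (hsub : ∀ x : Site P j, x ∉ C → laplace 1 v x ≤ 0) (hle : ∀ c ∈ C, v c ≤ 0) (x : Site P j) : v x ≤ 0 := by
  set w : SiteField P j ℝ := fun y => max (v y) 0 with hw
  have hwC : ∀ c ∈ C, w c = 0 := fun c hc => by rw [hw]; exact max_eq_right (hle c hc)
  -- `Σ_x w·Δv ≤ 0`
  have hS : ∑ y : Site P j, w y * laplace 1 v y ≤ 0 := by
    refine Finset.sum_nonpos fun y _ => ?_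
    by_cases hy : y ∈ C
    · rw [hwC y hy, zero_mul]
    · exact mul_nonpos_of_nonneg_of_nonpos (le_max_right _ _) (hsub y hy)
  -- `Σ_x w·Δv = Σ_b ∂w·∂v ≥ Σ_b (∂w)²`
  rw [sum_mul_laplace_eq_sum_grad_mul] at hS
  have hge : ∑ b : PBond P j, grad 1 w b ^ 2 ≤ ∑ b : PBond P j, grad 1 w b * grad 1 v b :=
    Finset.sum_le_sum fun b _ => by
      simp only [grad, one_smul, hw]
      exact posPart_sub_sq_le _ _
  have hzero : ∀ b : PBond P j, grad 1 w b = 0 := by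
    have hsum : ∑ b : PBond P j, grad 1 w b ^ 2 = 0 :=
      le_antisymm (hge.trans hS) (Finset.sum_nonneg fun b _ => sq_nonneg _)
    intro b
    have := (Finset.sum_eq_zero_iff_of_nonneg fun b _ => sq_nonneg (grad 1 w b)).mp hsum b (Finset.mem_univ b)
    exact pow_eq_zero_iff (n := 2) (by norm_num) |>.mp this
  obtain ⟨c₀, hc₀⟩ := hC
  have hconst : w x = w c₀ := by
    rw [const_of_grad_eq_zero one_ne_zero hzero x, const_of_grad_eq_zero one_ne_zero hzero c₀]
  have : w x = 0 := by rw [hconst, hwC c₀ hc₀]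
  have hvx : v x ≤ w x := le_max_left _ _
  linarith

/-- ★ **COMPARISON**: `w` sub-mean-value off `C`, `h` harmonic off `C`, `w ≤ h` on the nonempty `C` ⇒ `w ≤ h`. [folklore] -/
theorem le_of_laplace_nonpos_off_of_le_on (C : Finset (Site P j)) (hC : C.Nonempty) (w h : SiteField P j ℝ)
    (hw : ∀ x : Site P j, x ∉ C → laplace 1 w x ≤ 0) (hh : ∀ x : Site P j, x ∉ C → laplace 1 h x = 0) (hle : ∀ c ∈ C, w c ≤ h c)
    (x : Site P j) : w x ≤ h x := by
  have key := nonpos_of_laplace_nonpos_off C hC (w - h) (fun y hy => by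
    rw [laplace_sub, Pi.sub_apply, hh y hy, sub_zero]; exact hw y hy) (fun c hc => by rw [Pi.sub_apply]; linarith [hle c hc]) x
  rw [Pi.sub_apply] at key
  linarith

/-- uniqueness for the pinned Dirichlet problem: two functions harmonic off the nonempty `C` that agree on `C` are equal. [folklore] -/
theorem eq_of_harmonic_off (C : Finset (Site P j)) (hC : C.Nonempty) (h₁ h₂ : SiteField P j ℝ)
    (hh₁ : ∀ x : Site P j, x ∉ C → laplace 1 h₁ x = 0) (hh₂ : ∀ x : Site P j, x ∉ C → laplace 1 h₂ x = 0) (heq : ∀ c ∈ C, h₁ c = h₂ c) :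
    h₁ = h₂ := by
  funext x
  exact le_antisymm
    (le_of_laplace_nonpos_off_of_le_on C hC h₁ h₂ (fun y hy => (hh₁ y hy).le) hh₂ (fun c hc => (heq c hc).le) x)
    (le_of_laplace_nonpos_off_of_le_on C hC h₂ h₁ (fun y hy => (hh₂ y hy).le) hh₁ (fun c hc => (heq c hc).ge) x)

/-- ★ **THE PINNED DIRICHLET PROBLEM IS SOLVABLE**: every datum on the nonempty `C` has a (unique) extension harmonic off `C` — the linear map
`h ↦ (h|_C, (Δh)|_{T∖C})` of the finite-dimensional space of site functions into itself is injective (maximum principle), hence surjective. [folklore] -/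
theorem exists_harmonic_ext (C : Finset (Site P j)) (hC : C.Nonempty) (g : SiteField P j ℝ) :
    ∃ h : SiteField P j ℝ, (∀ c ∈ C, h c = g c) ∧ ∀ x : Site P j, x ∉ C → laplace 1 h x = 0 := by
  classical
  let Φ : SiteField P j ℝ →ₗ[ℝ] SiteField P j ℝ :=
    { toFun := fun h x => if x ∈ C then h x else laplace 1 h x
      map_add' := fun f f' => by
        funext x
        by_cases hx : x ∈ C
        · simp [hx]
        · simp [hx, laplace_add]
      map_smul' := fun a f => by
        funext x
        by_cases hx : x ∈ C
        · simp [hx]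
        · simp [hx, laplace_smul] }
  have hΦC : ∀ (f : SiteField P j ℝ) (c : Site P j), c ∈ C → Φ f c = f c := fun f c hc => by
    show (if c ∈ C then f c else laplace 1 f c) = f c
    rw [if_pos hc]
  have hΦoff : ∀ (f : SiteField P j ℝ) (x : Site P j), x ∉ C → Φ f x = laplace 1 f x := fun f x hx => by
    show (if x ∈ C then f x else laplace 1 f x) = laplace 1 f x
    rw [if_neg hx]
  have hinj : Function.Injective Φ := by
    refine (injective_iff_map_eq_zero Φ).mpr fun f hf => ?_
    have hfx : ∀ x, Φ f x = 0 := fun x => congrFun hf x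
    refine eq_of_harmonic_off C hC f 0 (fun x hx => ?_) (fun x _ => by rw [laplace_zero]; rfl) (fun c hc => ?_)
    · rw [← hΦoff f x hx]; exact hfx x
    · rw [← hΦC f c hc]; exact hfx c
  obtain ⟨h, hh⟩ := (LinearMap.injective_iff_surjective.mp hinj) (fun x => if x ∈ C then g x else 0)
  refine ⟨h, fun c hc => ?_, fun x hx => ?_⟩
  · have h1 := congrFun hh c
    rw [hΦC h c hc] at h1
    rw [h1, if_pos hc]
  · have h1 := congrFun hh x
    rw [hΦoff h x hx] at h1
    rw [h1, if_neg hx]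


/-! ## §2 Translations of `T^{(j)}`; the total mass of a function harmonic off a homogeneous centre set -/

/-- the lattice Laplacian commutes with translations: `Δ(w(· + a))(x) = (Δw)(x + a)`. [folklore] -/
theorem laplace_translate (w : SiteField P j ℝ) (a x : Site P j) :
    laplace 1 (fun y => w (y + a)) x = laplace 1 w (x + a) := by
  rw [laplace_one_apply, laplace_one_apply]
  refine Finset.sum_congr rfl fun μ _ => ?_
  rw [Site.shift_add, Site.unshift_add]

/-- ★★ **TOTAL MASS OF A FUNCTION HARMONIC OFF A HOMOGENEOUS CENTRE SET**: if every two points of the nonempty `C` are exchanged by a translation of `T^{(j)}` preserving `C`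
(the `k`-centres: translations by `L^k·e_μ`), then every `h` harmonic off `C` has `|C|·Σ_x h(x) = |T^{(j)}|·Σ_{c∈C} h(c)`.  Proof: average `h` over the (finite) stabiliser
`G` of `C`; the average is harmonic off `C` and constant on `C` (transitivity), hence constant (uniqueness), and both sides are read off. [folklore] -/
theorem card_mul_sum_eq_of_harmonic_off (C : Finset (Site P j)) (hC : C.Nonempty)
    (htrans : ∀ c ∈ C, ∀ c' ∈ C, ∃ a : Site P j, (∀ x : Site P j, x ∈ C ↔ x + a ∈ C) ∧ c + a = c')
    (h : SiteField P j ℝ) (hh : ∀ x : Site P j, x ∉ C → laplace 1 h x = 0) :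
    (C.card : ℝ) * ∑ x : Site P j, h x = (Fintype.card (Site P j) : ℝ) * ∑ c ∈ C, h c := by
  classical
  -- the stabiliser of `C`
  set G : Finset (Site P j) := Finset.univ.filter (fun a => ∀ x : Site P j, x ∈ C ↔ x + a ∈ C) with hG
  have hmemG : ∀ a : Site P j, a ∈ G ↔ ∀ x : Site P j, x ∈ C ↔ x + a ∈ C := fun a => by
    rw [hG, Finset.mem_filter]; simp
  have h0G : (0 : Site P j) ∈ G := (hmemG 0).mpr fun x => by rw [add_zero]
  have hGadd : ∀ a ∈ G, ∀ b ∈ G, a + b ∈ G := fun a ha b hb => (hmemG _).mpr fun x => by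
    rw [(hmemG a).mp ha x, (hmemG b).mp hb (x + a), add_assoc]
  have hGsub : ∀ a ∈ G, ∀ b ∈ G, b - a ∈ G := fun a ha b hb => (hmemG _).mpr fun x => by
    rw [(hmemG b).mp hb x, (hmemG a).mp ha (x + (b - a))]
    constructor <;> intro hx
    · rwa [add_assoc, sub_add_cancel]
    · rwa [add_assoc, sub_add_cancel] at hx
  -- the average `H x = Σ_{a∈G} h(x + a)`
  set H : SiteField P j ℝ := fun x => ∑ a ∈ G, h (x + a) with hH
  have hHarm : ∀ x : Site P j, x ∉ C → laplace 1 H x = 0 := by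
    intro x hx
    have : H = ∑ a ∈ G, (fun y => h (y + a)) := by
      funext y; rw [hH]; simp [Finset.sum_apply]
    rw [this]
    have hlin : laplace 1 (∑ a ∈ G, (fun y : Site P j => h (y + a))) x = ∑ a ∈ G, laplace 1 (fun y : Site P j => h (y + a)) x := by
      induction G using Finset.induction_on with
      | empty => rw [Finset.sum_empty, Finset.sum_empty, laplace_zero]; rfl
      | insert a s has ih => rw [Finset.sum_insert has, Finset.sum_insert has, laplace_add, Pi.add_apply, ih]
    rw [hlin]
    refine Finset.sum_eq_zero fun a ha => ?_
    rw [laplace_translate]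
    exact hh (x + a) (fun hxa => hx (((hmemG a).mp ha x).mpr hxa))
  -- `H` is constant on `C`
  obtain ⟨c₀, hc₀⟩ := hC
  have hHC : ∀ c ∈ C, H c = H c₀ := by
    intro c hc
    obtain ⟨a₀, ha₀, hca⟩ := htrans c₀ hc₀ c hc
    have ha₀G : a₀ ∈ G := (hmemG a₀).mpr ha₀
    rw [hH]
    show ∑ a ∈ G, h (c + a) = ∑ a ∈ G, h (c₀ + a)
    rw [← hca]
    -- reindex `a ↦ a₀ + a` on `G`
    refine Finset.sum_equiv (Equiv.addLeft a₀) (fun a => ?_) (fun a _ => by rw [Equiv.coe_addLeft, add_assoc])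
    rw [Equiv.coe_addLeft]
    constructor
    · intro ha; exact hGadd a₀ ha₀G a ha
    · intro ha
      have := hGsub a₀ ha₀G (a₀ + a) ha
      rwa [add_sub_cancel_left] at this
  -- hence constant everywhere
  have hHconst : ∀ x : Site P j, H x = H c₀ := by
    have heq := eq_of_harmonic_off C ⟨c₀, hc₀⟩ H (fun _ => H c₀) hHarm (fun x _ => by
      rw [laplace_one_apply]; exact Finset.sum_eq_zero fun μ _ => by ring) hHC
    exact fun x => congrFun heq x
  -- read off `Σ_x H` and `Σ_C H` in two ways
  have hsumT : ∑ x : Site P j, H x = (G.card : ℝ) * ∑ x : Site P j, h x := by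
    rw [hH]
    show ∑ x : Site P j, ∑ a ∈ G, h (x + a) = (G.card : ℝ) * ∑ x : Site P j, h x
    rw [Finset.sum_comm]
    have : ∀ a ∈ G, ∑ x : Site P j, h (x + a) = ∑ x : Site P j, h x := fun a _ =>
      Fintype.sum_equiv (Equiv.addRight a) _ _ fun x => rfl
    rw [Finset.sum_congr rfl this, Finset.sum_const, nsmul_eq_mul]
  have hsumC : ∑ c ∈ C, H c = (G.card : ℝ) * ∑ c ∈ C, h c := by
    rw [hH]
    show ∑ c ∈ C, ∑ a ∈ G, h (c + a) = (G.card : ℝ) * ∑ c ∈ C, h c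
    rw [Finset.sum_comm]
    have : ∀ a ∈ G, ∑ c ∈ C, h (c + a) = ∑ c ∈ C, h c := fun a ha =>
      Finset.sum_equiv (Equiv.addRight a) (fun x => by rw [Equiv.coe_addRight]; exact (hmemG a).mp ha x) (fun x _ => rfl)
    rw [Finset.sum_congr rfl this, Finset.sum_const, nsmul_eq_mul]
  have hsumT' : ∑ x : Site P j, H x = (Fintype.card (Site P j) : ℝ) * H c₀ := by
    rw [Finset.sum_congr rfl fun x _ => hHconst x, Finset.sum_const, nsmul_eq_mul, Finset.card_univ]
  have hsumC' : ∑ c ∈ C, H c = (C.card : ℝ) * H c₀ := by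
    rw [Finset.sum_congr rfl fun c hc => hHC c hc, Finset.sum_const, nsmul_eq_mul]
  have hGpos : (0 : ℝ) < G.card := by exact_mod_cast Finset.card_pos.mpr ⟨0, h0G⟩
  -- `|G|·|C|·Σ_T h = |C|·|T|·H(c₀) = |T|·|G|·Σ_C h`
  have key : (G.card : ℝ) * ((C.card : ℝ) * ∑ x : Site P j, h x) = (G.card : ℝ) * ((Fintype.card (Site P j) : ℝ) * ∑ c ∈ C, h c) := by
    calc (G.card : ℝ) * ((C.card : ℝ) * ∑ x : Site P j, h x) = (C.card : ℝ) * ∑ x : Site P j, H x := by rw [hsumT]; ring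
      _ = (C.card : ℝ) * ((Fintype.card (Site P j) : ℝ) * H c₀) := by rw [hsumT']
      _ = (Fintype.card (Site P j) : ℝ) * ((C.card : ℝ) * H c₀) := by ring
      _ = (Fintype.card (Site P j) : ℝ) * ∑ c ∈ C, H c := by rw [hsumC']
      _ = (G.card : ℝ) * ((Fintype.card (Site P j) : ℝ) * ∑ c ∈ C, h c) := by rw [hsumC]; ring
  exact mul_left_cancel₀ hGpos.ne' key

/-- ★★ **SUB-MEAN-VALUE FUNCTIONS**: under the same homogeneity of the nonempty `C`, a function that is sub-mean-value off `C` (`(Δw)(x) ≤ 0`, `x ∉ C`) has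
`|C|·Σ_x w(x) ≤ |T^{(j)}|·Σ_{c∈C} w(c)` — compare `w` with the harmonic extension of `w|_C`. [folklore] -/
theorem card_mul_sum_le_of_laplace_nonpos_off (C : Finset (Site P j)) (hC : C.Nonempty)
    (htrans : ∀ c ∈ C, ∀ c' ∈ C, ∃ a : Site P j, (∀ x : Site P j, x ∈ C ↔ x + a ∈ C) ∧ c + a = c')
    (w : SiteField P j ℝ) (hw : ∀ x : Site P j, x ∉ C → laplace 1 w x ≤ 0) :
    (C.card : ℝ) * ∑ x : Site P j, w x ≤ (Fintype.card (Site P j) : ℝ) * ∑ c ∈ C, w c := by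
  obtain ⟨h, hhC, hh⟩ := exists_harmonic_ext C hC w
  have hle : ∀ x, w x ≤ h x := le_of_laplace_nonpos_off_of_le_on C hC w h hw hh (fun c hc => (hhC c hc).ge)
  calc (C.card : ℝ) * ∑ x : Site P j, w x ≤ (C.card : ℝ) * ∑ x : Site P j, h x :=
        mul_le_mul_of_nonneg_left (Finset.sum_le_sum fun x _ => hle x) (Nat.cast_nonneg _)
    _ = (Fintype.card (Site P j) : ℝ) * ∑ c ∈ C, h c := card_mul_sum_eq_of_harmonic_off C hC htrans h hh
    _ = (Fintype.card (Site P j) : ℝ) * ∑ c ∈ C, w c := by rw [Finset.sum_congr rfl fun c hc => hhC c hc]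

/-- the square of a non-negative function that is sub-mean-value in the averaged form `2d·u(x) ≤ Σ_μ(u(x+e_μ) + u(x−e_μ))` is sub-mean-value: `(Δu²)(x) ≤ 0`
(Cauchy–Schwarz over the `2d` neighbours). [folklore] -/
theorem laplace_sq_nonpos_of_subMean (u : SiteField P j ℝ) (hu0 : ∀ y : Site P j, 0 ≤ u y) (x : Site P j)
    (hsub : 2 * (P.d : ℝ) * u x ≤ ∑ μ : Fin P.d, (u (x.shift μ) + u (x.unshift μ))) :
    laplace 1 (fun y => u y ^ 2) x ≤ 0 := by
  rw [laplace_one_apply]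
  have hd : (0 : ℝ) < P.d := by exact_mod_cast P.hd
  -- `(Σ_μ (a_μ + b_μ))² ≤ d·Σ_μ (a_μ + b_μ)² ≤ 2d·Σ_μ (a_μ² + b_μ²)`
  have hCS : (∑ μ : Fin P.d, (u (x.shift μ) + u (x.unshift μ))) ^ 2 ≤ (P.d : ℝ) * ∑ μ : Fin P.d, (u (x.shift μ) + u (x.unshift μ)) ^ 2 := by
    have := sq_sum_le_card_mul_sum_sq (s := (Finset.univ : Finset (Fin P.d))) (f := fun μ => u (x.shift μ) + u (x.unshift μ))
    simpa [Finset.card_univ, Fintype.card_fin] using this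
  have h2 : ∑ μ : Fin P.d, (u (x.shift μ) + u (x.unshift μ)) ^ 2 ≤ 2 * ∑ μ : Fin P.d, (u (x.shift μ) ^ 2 + u (x.unshift μ) ^ 2) := by
    rw [Finset.mul_sum]
    exact Finset.sum_le_sum fun μ _ => by nlinarith [sq_nonneg (u (x.shift μ) - u (x.unshift μ))]
  have hS0 : 0 ≤ ∑ μ : Fin P.d, (u (x.shift μ) + u (x.unshift μ)) := Finset.sum_nonneg fun μ _ => add_nonneg (hu0 _) (hu0 _)
  have hux : 0 ≤ u x := hu0 x
  -- `(2d·u(x))² ≤ (Σ)² ≤ 2d·Σ(a²+b²)`, divide by `2d`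
  have h3 : (2 * (P.d : ℝ) * u x) ^ 2 ≤ 2 * (P.d : ℝ) * ∑ μ : Fin P.d, (u (x.shift μ) ^ 2 + u (x.unshift μ) ^ 2) := by
    calc (2 * (P.d : ℝ) * u x) ^ 2 ≤ (∑ μ : Fin P.d, (u (x.shift μ) + u (x.unshift μ))) ^ 2 :=
          pow_le_pow_left₀ (by positivity) hsub 2
      _ ≤ (P.d : ℝ) * (2 * ∑ μ : Fin P.d, (u (x.shift μ) ^ 2 + u (x.unshift μ) ^ 2)) :=
          hCS.trans (mul_le_mul_of_nonneg_left h2 hd.le)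
      _ = 2 * (P.d : ℝ) * ∑ μ : Fin P.d, (u (x.shift μ) ^ 2 + u (x.unshift μ) ^ 2) := by ring
  have h4 : 2 * (P.d : ℝ) * u x ^ 2 ≤ ∑ μ : Fin P.d, (u (x.shift μ) ^ 2 + u (x.unshift μ) ^ 2) := by
    have h2d : (0 : ℝ) < 2 * P.d := by positivity
    have : 2 * (P.d : ℝ) * (2 * (P.d : ℝ) * u x ^ 2) ≤ 2 * (P.d : ℝ) * ∑ μ : Fin P.d, (u (x.shift μ) ^ 2 + u (x.unshift μ) ^ 2) := by
      calc 2 * (P.d : ℝ) * (2 * (P.d : ℝ) * u x ^ 2) = (2 * (P.d : ℝ) * u x) ^ 2 := by ring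
        _ ≤ _ := h3
    exact le_of_mul_le_mul_left this h2d
  have hsum : ∑ μ : Fin P.d, (2 * u x ^ 2 - u (x.shift μ) ^ 2 - u (x.unshift μ) ^ 2)
      = 2 * (P.d : ℝ) * u x ^ 2 - ∑ μ : Fin P.d, (u (x.shift μ) ^ 2 + u (x.unshift μ) ^ 2) := by
    rw [Finset.sum_sub_distrib, Finset.sum_sub_distrib, Finset.sum_const, Finset.card_univ, Fintype.card_fin, nsmul_eq_mul, Finset.sum_add_distrib]
    ring
  rw [hsum]
  linarith

/-- ★★ **SQUARES**: a non-negative function, sub-mean-value off the homogeneous nonempty `C` in the averaged form, has `|C|·Σ_x u(x)² ≤ |T^{(j)}|·Σ_{c∈C} u(c)²`. [folklore] -/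
theorem card_mul_sum_sq_le_of_subMean_off (C : Finset (Site P j)) (hC : C.Nonempty)
    (htrans : ∀ c ∈ C, ∀ c' ∈ C, ∃ a : Site P j, (∀ x : Site P j, x ∈ C ↔ x + a ∈ C) ∧ c + a = c')
    (u : SiteField P j ℝ) (hu0 : ∀ y : Site P j, 0 ≤ u y)
    (hsub : ∀ x : Site P j, x ∉ C → 2 * (P.d : ℝ) * u x ≤ ∑ μ : Fin P.d, (u (x.shift μ) + u (x.unshift μ))) :
    (C.card : ℝ) * ∑ x : Site P j, u x ^ 2 ≤ (Fintype.card (Site P j) : ℝ) * ∑ c ∈ C, u c ^ 2 :=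
  card_mul_sum_le_of_laplace_nonpos_off C hC htrans (fun y => u y ^ 2) fun x hx => laplace_sq_nonpos_of_subMean u hu0 x (hsub x hx)

end Flat

end Summit.QuantumFields.YangMills.Theorems.Prop7PinnedHarmonicMeasure

end
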